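/-
Copyright: statement-level skeleton of a published paper (lit-balaban cell, Phase-2 proof seat p25, gen 22). No proof
claims beyond what the kernel checks below.
-/
import Literature.MathematicalPhysics.QuantumFieldTheory.BalabanImbrieJaffe1984to88.BIJ88WalkSplit245Letters
import Literature.MathematicalPhysics.QuantumFieldTheory.BalabanImbrieJaffe1984to88.BIJ88WalkSplitReach
import Literature.MathematicalPhysics.QuantumFieldTheory.BalabanImbrieJaffe1984to88.BIJ88WalkRegionWeightsSummable
import Literature.MathematicalPhysics.QuantumFieldTheory.BalabanImbrieJaffe1984to88.BIJ88WalkProductCutoffWeighted312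

/-!
# `BalabanImbrieJaffe1984to88.BIJ88WalkIneq312Split245` — T. Bałaban, J. Imbrie, A. Jaffe, *Effective action and
cluster properties of the abelian Higgs model*, Commun. Math. Phys. **114** (1988) 257–315 [BalabanImbrieJaffe1988],
§5.14 p. 312 [PDF 56], verbatim (x2 render `lit-balaban-r16/renders/cmp114/original-p056-x2.png`): *"These
considerations lead to the following estimate: |G_k(X)| ≤ c(F(X))(e^β(L^kε/ε₀)^{1/4−α})^{β′|X∖∪_cX_c|} ×
Π_{X_{σ_1} ⊂ X : dist(X_{σ_1}, Λ₁₂^{(k)c}) < r(e_k)} [c(L^kε)^{−m(c)}e^{−m′(c)}]."*, p. 310 [PDF 54]: *"We give random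
walk expansions for the propagators C^{(k)}_{Λ₁₂^{(k)}}, C^{(k)}_{Λ₁₂^{(k)}}(u_{k+1}) produced in this step. The leading
terms, with only propagators C^{(k)}_{Λ₁₂^{(k)},loc}, C^{(k)}_{Λ₁₂^{(k)},loc}(u_{k+1}), we transform further. The others,
localized in region X, have a factor of e^{−cr(e_k)|X|}."* and Sect. 2 p. 264 [PDF 8]: *"Then we define C^{(k)}_Λ(u)
= C^{(k)}_{Λ,loc}(u) + Σ_X C^{(k)}_{Λ,X}(u), (2.45) … |C^{(k)}_{Λ,X}(u; x₁, x₂)| ≦ e^{−cr(e_k)|X|}. (2.46)"* — **THE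
HEAD THEOREM OF ROW C2.Claim@312 ON PRINT'S SPLIT (2.45)** (p25 gen 22; file W6b, a MEMBER of the row, owner r16,
referee ref-5; the head of record `BIJ88WalkIneq312RemainderBdry.ineq312_remainder_bdry` and every earlier file
UNCHANGED).

ONE CALL of gen 21's `BIJ88WalkProductCutoffWeighted312.ineq312_remainder_bdry_prodCutoff_of_reach` (product
cutoffs, `hE` discharged, locality from reach data) with: the covariance family `none ↦ C^{(k)}_{Λ,loc}`,
`some X ↦ C^{(k)}_{Λ,X}` of p13's `BIJ88RandomWalk242` over the CONNECTED unions `X` of `r(e_k)`-cubes (*"Let X be a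
connected union of r(e_k)-cubes"*; a subtype), `C_loc` non-triggering, `C_X` triggering with small-factor region `X`;
the reach data of W4c (`split_reach`, `split_weights`) fed by the support inputs `split245_support_adm` and the
per-cube animal sums `split245_cube_sums` (W4b on the subtype) of THIS file; and the analytic letters of W6a
(`BIJ88WalkSplit245Letters.split245_letters`: `hB`, `hBf`, `hBzN`, `hloc`, `hwalk` DERIVED from the typed row
(2.46), an entrywise letter on `C_loc`, `≤ s_c` sites per cube, `near`-degree `≤ D`).  Result
(`ineq312_remainder_bdry_split245`): the typed leaf `Ineq312` for the located remainder activities of the §5.13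
model of record with print's product cutoffs, on print's split, with the constant
`c_F(O) = K_V·Λ_O^{mom}·(max 1 (2Φ₀(O) + L(D+1)))^{Φ₀(O)}` — `ρ₀ = 2`, `ρ₁ = D + 1` are NUMBERS (no volume, no `N₀`):
what print pays with *"a factor of e^{−cr(e_k)|X|}"* is booked by the weights `λ^{|X|}`, `λ = e^{−c·r(e_k)/2}`, summed
per cube by the lattice-animal bound, and by `θ^{|X|}`, `θ ≥ e^{−c·r(e_k)/4}`.  What stays HYPOTHESIS: the typed row
(2.46) and the `C_loc` letter (both PROVED in [6]'s setting elsewhere in the tree: p36's `BIJ88Ineq246Walks.ineq246`,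
p02's `BIJ88Decay241Walks.abs_cLoc_le_exp` — not re-derived for the model of record), the lattice geometry, three
largeness conditions on `c·r(e_k)` (`4 ≤ c·r(e_k)`, `(Δ+1)²e·e^{−c·r(e_k)/2} ≤ ½`, `e^{−c·r(e_k)/4}·s_c·R₁K_w ≤ θ_w`)
and `E_loc·D·s_c·R₁K_w ≤ B_ℓ`, and the head's clauses C2 (`hvert`), C4 (`hbeat`), C5 (`bdry`), `K_V`, (5.2.3).

statement-level skeleton of published theorems with citation tags; proofs where landed; nothing here is a claim
about the Yang–Mills mass gap

PDF held: `paper:balaban1988-cmp114-bij-abelian-higgs-effective-action` (journal page = PDF page + 256); p. 312 =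
PDF 56, p. 310 = PDF 54 (re-read this session from the x2 render), p. 264 = PDF 8.

CITATION HEADER (lean-in-tree rule).  lit-balaban cell (HOME `run/shared/lean/pub/lit-balaban/`), Phase 2, seat p25
gen 22; row **C2.Claim@312** of `HOME/lit-balaban-r16/ROWS-C2-part2.md` (owner r16, referee ref-5; MEMBER).  USED BY
NAME, nothing restated: `BIJ88WalkProductCutoffWeighted312.ineq312_remainder_bdry_prodCutoff_of_reach` (W5),
`BIJ88WalkSplitReach.{split_reach, split_weights}` (W4c), `BIJ88WalkRegionWeightsSummable.region_weights_summable`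
(W4b), `BIJ88WalkSplit245Letters.{split245_letters, cube_mem_of_cX_ne_zero}` (W6a), `BIJ88WalkSplitSupport245.cLoc_ne_zero_near`
(W4d), `BIJ88RandomWalk242.{cLoc, cX, memX, closure}` (p13), `BIJ88Sect2Statements.Ineq246` (r18), the typed leaf
`BIJ88Sect5StatementsPart4.Ineq312` (r16), `Literature.Probability.LatticeModels.IsRConnected`, the §5.13 model of
record (`prec`, `src`, `corner`, `weight`, `source`, `remAt`, `remSys`, `phi0`, `nfreeOf`, `expand`, `vexp`).

## What is proved (0 `sorry`, standard axioms, no new `Prop` facts; theorems only, no definitions)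

* `split245_support_adm` (reach inputs `hnone`, `hsome` on the connected subtype), `split245_cube_sums` (per-cube
  sums `≤ 1`, `≤ 1` of `λ^{|X|}`, `λ^{|X|}·|X|` over connected `X ∋ k`, `(Δ+1)²eλ ≤ ½`);
* **`ineq312_remainder_bdry_split245`** — the head theorem of the row on print's split (2.45).
HONEST SCOPE: (a) W6a's (a)–(c); (b) the identification of p13's abstract walk kernels `C_ω` with the operators of
(2.40) for the model of record is NOT made here (the row (2.46) is the interface); (c) pre-cluster-expansion ((H5) of
the head); (d) directions = one-cube vectors with `‖u‖_∞ ≤ R_∞`, `Σ|u| ≤ R₁` (observables' and legs' test vectors are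
HYPOTHESISED to be such).  NOT summit progress; NOT continuum; NOT Clay.  Imports `BIJ88WalkSplit245Letters`,
`BIJ88WalkSplitReach`, `BIJ88WalkRegionWeightsSummable`, `BIJ88WalkProductCutoffWeighted312`; modifies nothing.
-/

noncomputable section

namespace Literature.MathematicalPhysics.QuantumFieldTheory.BalabanImbrieJaffe1984to88.BIJ88WalkIneq312Split245

open Classical MeasureTheory Matrix Finset
open scoped BigOperators ContDiff
open Literature.MathematicalPhysics.QuantumFieldTheory.Balaban1983to89
open B2Eq228Conditioning (weight source)
open BIJ88PolymerRep5134 (corner)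
open BIJ88PolymerRep5134Gauss (prec src)
open BIJ88VertexIbp311 (vexp)
open BIJ88RandomWalk242
open BIJ88WalkSplitSupport245 (cLoc_ne_zero_near)
open BIJ88WalkRegionWeightsSummable (region_weights_summable)
open BIJ88WalkSplitReach (split_reach split_weights)
open BIJ88WalkSplit245Letters (split245_letters cube_mem_of_cX_ne_zero)
open BIJ88WalkRun311 BIJ88WalkExpansion311 BIJ88WalkExpansionGeo311 BIJ88WalkTermCount312
  BIJ88WalkRemainderActivity312 BIJ88WalkIneq312Remainder BIJ88WalkProductCutoffWeighted312
open Literature.Probability.LatticeModels (IsRConnected)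

/-! ## §1  The reach inputs and the per-cube sums of print's split on the connected subtype -/

section Inputs

variable {J S K : Type} [DecidableEq J] [Fintype K] [DecidableEq K]

/-- **THE REACH INPUTS OF THE SPLIT ON THE ADMISSIBLE SUBTYPE** (`hnone`, `hsome` of `BIJ88WalkSplitReach.split_reach`
with `X := Subtype.val`): the local part is nonzero only between sites with `near` cubes (finite range, W4d), the part
of `X` only between sites whose cubes lie in `X` (the row's support clause). [cite: BalabanImbrieJaffe1988, (2.43)-(2.46) p.264] -/
theorem split245_support_adm (ldist : J → S → ℝ) (ρr : ℝ) (cubeOf : J → K) (cadj : K → K → Prop)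
    (Cw : Walk J → S → S → ℝ) (inBlock : S → J → Prop) (cube : S → K) (Adm : Finset K → Prop) {c rek : ℝ}
    (h246 : BIJ88Sect2Statements.Ineq246 (fun X : Finset K => X.card) (memX inBlock cubeOf cadj)
      (cX ldist ρr cubeOf cadj Cw) c rek)
    (hblk : ∀ x j, inBlock x j → cube x ∈ closure cadj {cubeOf j})
    (sdist : S → S → ℝ) (htri : ∀ j x₁ x₂, sdist x₁ x₂ ≤ ldist j x₁ + ldist j x₂) (near : K → K → Prop)
    (hnear : ∀ x₁ x₂, sdist x₁ x₂ ≤ 2 * ρr → near (cube x₂) (cube x₁)) :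
    (∀ x y', (fun p : Option {X : Finset K // Adm X} =>
        (Option.elim p (cLoc ldist ρr Cw) fun r => cX ldist ρr cubeOf cadj Cw r.1 : Matrix S S ℝ)) none x y' ≠ 0 →
        near (cube y') (cube x)) ∧
    (∀ (r : {X : Finset K // Adm X}) x y', (fun p : Option {X : Finset K // Adm X} =>
        (Option.elim p (cLoc ldist ρr Cw) fun r => cX ldist ρr cubeOf cadj Cw r.1 : Matrix S S ℝ)) (some r) x y' ≠ 0 →
        cube x ∈ (fun r : {X : Finset K // Adm X} => r.1) r ∧ cube y' ∈ (fun r : {X : Finset K // Adm X} => r.1) r) :=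
  ⟨fun _ _ h => cLoc_ne_zero_near ldist ρr Cw sdist htri cube near hnear h,
    fun _ _ _ h => cube_mem_of_cX_ne_zero ldist ρr cubeOf cadj Cw inBlock cube h246 hblk h⟩

omit [DecidableEq J] in
/-- **THE PER-CUBE SUMS OF THE REGION WEIGHTS** (inputs `ha`, `hb` of `BIJ88WalkSplitReach.split_weights` with
`X := Subtype.val`, `ρ_X = λ^{|X|}`): over the CONNECTED regions through a cube `k` (cube adjacency `R_K` symmetric of
degree `≤ Δ`), `Σ_{X ∋ k} λ^{|X|} ≤ 1` and `Σ_{X ∋ k} λ^{|X|}·|X| ≤ 1` whenever `(Δ+1)²·eλ ≤ ½` — W4b's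
`region_weights_summable` on the subtype (which gives `2λ`, `2eλ`), uniformly in the volume.
[cite: BalabanImbrieJaffe1988, §5.14 p.310; Sect. 2 (2.46) p.264–265] -/
theorem split245_cube_sums (Rk : K → K → Prop) (hRk : ∀ x y, Rk x y → Rk y x) {nbr : K → Finset K} {Δ : ℕ}
    (hΔ : ∀ x, (nbr x).card ≤ Δ) (hnbr : ∀ x y, Rk x y → y ∈ nbr x) {lam : ℝ} (hlam : 0 ≤ lam)
    (hsmall : ((Δ : ℝ) + 1) ^ 2 * (Real.exp 1 * lam) ≤ 1 / 2) (k : K) :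
    (∑ r ∈ univ.filter (fun r : {X : Finset K // IsRConnected Rk X} => k ∈ r.1), lam ^ r.1.card) ≤ 1 ∧
    (∑ r ∈ univ.filter (fun r : {X : Finset K // IsRConnected Rk X} => k ∈ r.1), lam ^ r.1.card * r.1.card) ≤ 1 := by
  haveI : DecidableRel Rk := fun a b => Classical.propDecidable _
  have h := region_weights_summable (P := {X : Finset K // IsRConnected Rk X}) hRk hΔ hnbr hlam hsmall
    (X := fun r => r.1) Subtype.val_injective (fun r => r.2) (sees := fun r k => k ∈ r.1) (fun _ _ h => h)
    (ρ := fun r => lam ^ r.1.card) (fun _ => le_rfl) k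
  -- `(Δ+1)² ≥ 1` and `e ≥ 1`: `2λ ≤ 2eλ ≤ 1`
  have he1 : 1 ≤ Real.exp 1 := Real.one_le_exp zero_le_one
  have hD1 : (1 : ℝ) ≤ ((Δ : ℝ) + 1) ^ 2 := one_le_pow₀ (by linarith [Nat.cast_nonneg (α := ℝ) Δ])
  have h2e : 2 * (Real.exp 1 * lam) ≤ 1 := by
    have : Real.exp 1 * lam ≤ ((Δ : ℝ) + 1) ^ 2 * (Real.exp 1 * lam) :=
      le_mul_of_one_le_left (mul_nonneg (zero_le_one.trans he1) hlam) hD1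
    linarith
  have h2 : 2 * lam ≤ 1 := by
    have : lam ≤ Real.exp 1 * lam := le_mul_of_one_le_left hlam he1
    linarith
  -- W4b's statement carries the classical `Decidable` instances of its abstract `sees` (subsingletons)
  constructor
  · have h1 := h.1.trans h2
    convert h1 using 4; rfl
  · have h1 := h.2.trans h2e
    convert h1 using 4; rfl

end Inputs

/-! ## §2  The head theorem of row C2.Claim@312 on print's split (2.45) -/

section Law

variable {ι : Type} [Fintype ι] {κ : Type} [LinearOrder κ] {β : Type} [Fintype β] [DecidableEq β]
variable {α I : Type} [Fintype α] [DecidableEq α] [Fintype I] [DecidableEq I]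
  {blk : α → I} {Δ : Matrix α α ℝ} {ℱ : α → ℝ} {W : Finset I} {J : Type} [DecidableEq J]

/-- **THE HEAD THEOREM OF ROW C2.Claim@312 ON PRINT'S SPLIT (2.45), PRODUCT CUTOFFS, VOLUME-FREE**:
`ineq312_remainder_bdry_prodCutoff_of_reach` for the family `none ↦ C_loc` (non-triggering, `reg = ∅`),
`some X ↦ C_X` (triggering, `reg = X`) of `BIJ88RandomWalk242` over the connected unions `X` of `r(e_k)`-cubes,
directions `Dir = {u : one cube, ‖u‖_∞ ≤ R_∞, Σ|u| ≤ R₁}`, site product cutoffs `Π_b χ₁(ψ(y_b)/p)` at distinct sites,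
weights `ρ_loc = 1`, `ρ_X = e^{−c·r(e_k)|X|/2}`, letters `B′_loc = E_loc·D·s_c·R₁K_w`, `B′_X = e^{−c·r(e_k)|X|/2}·|X|·s_c·R₁K_w`
(`K_w = R_∞ + ‖ℱ|_W‖_∞ + 1`).  INPUTS: the typed row (2.46) for the `C_X`, an entrywise letter `E_loc` and the finite
range of `C_loc`, the lattice geometry (`hblk`, `htri`, `hnear`, `≤ s_c` sites per cube, `near`-degree `≤ D`, cube
adjacency of degree `≤ Δ`), legs in one cube with `≤ L` per cube, and the NUMBERS `4 ≤ c·r(e_k)`, `e^{−c·r(e_k)/4} ≤ θ`,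
`(Δ+1)²e·e^{−c·r(e_k)/2} ≤ ½`, `E_loc·D·s_c·R₁K_w ≤ B_ℓ`, `e^{−c·r(e_k)/4}·s_c·R₁K_w ≤ θ_w`; the head's `hvert`,
`hbeat`, `bdry`, `K_V`, (5.2.3), moment letters verbatim.  CONCLUSION: `Ineq312` with
`c_F(O) = K_V·Λ_O·(max 1 (2Φ₀(O) + L(D+1)))^{Φ₀(O)}` — no volume letter.
[cite: BalabanImbrieJaffe1988, §5.14 p.312 (estimate preceding (5.14.5)); p.310; (2.43)-(2.46) p.264; (5.2.1)-(5.2.4) p.278] -/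
theorem ineq312_remainder_bdry_split245 (hPD : (prec blk Δ W (corner ℝ W)).PosDef)
    (ldist : J → {x : α // blk x ∈ W} → ℝ) (ρr : ℝ) (cubeOf : J → β) (cadj : β → β → Prop)
    (Cw : Walk J → {x : α // blk x ∈ W} → {x : α // blk x ∈ W} → ℝ) (inBlock : {x : α // blk x ∈ W} → J → Prop)
    (cube : {x : α // blk x ∈ W} → β) {c rek : ℝ}
    (h246 : BIJ88Sect2Statements.Ineq246 (fun X : Finset β => X.card) (memX inBlock cubeOf cadj)
      (cX ldist ρr cubeOf cadj Cw) c rek)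
    (hblk : ∀ x j, inBlock x j → cube x ∈ closure cadj {cubeOf j})
    {Eloc : ℝ} (hE0 : 0 ≤ Eloc) (hEloc : ∀ x y, |cLoc ldist ρr Cw x y| ≤ Eloc)
    (sdist : {x : α // blk x ∈ W} → {x : α // blk x ∈ W} → ℝ)
    (htri : ∀ j x₁ x₂, sdist x₁ x₂ ≤ ldist j x₁ + ldist j x₂) (near : β → β → Prop)
    (hnear : ∀ x₁ x₂, sdist x₁ x₂ ≤ 2 * ρr → near (cube x₂) (cube x₁)) {D sc : ℕ}
    (hD : ∀ k, (univ.filter fun k' => near k k').card ≤ D)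
    (hsc : ∀ k, (univ.filter fun x => cube x = k).card ≤ sc)
    (Rk : β → β → Prop) (hRk : ∀ x y, Rk x y → Rk y x) {nbr : β → Finset β} {Δc : ℕ}
    (hΔc : ∀ x, (nbr x).card ≤ Δc) (hnbr : ∀ x y, Rk x y → y ∈ nbr x)
    (hsmall : ((Δc : ℝ) + 1) ^ 2 * (Real.exp 1 * Real.exp (-(c * rek / 2))) ≤ 1 / 2)
    {Rinf R1 : ℝ} (hRinf : 0 ≤ Rinf) (hR1 : 0 ≤ R1)
    {cv : ι → ℝ} {legs : ι → List ({x : α // blk x ∈ W} → ℝ)} {obs : κ → List ({x : α // blk x ∈ W} → ℝ)} {M : ℕ}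
    {oc : κ → Finset β} {vc : ι → Finset β} {cV : ι → ℝ} {Bl θ θv θw : ℝ} {legCube : ι → ℕ → β} {L : ℕ}
    {B : Type} (Bs : Finset B) {y : B → {x : α // blk x ∈ W}} (hy : Set.InjOn y Bs)
    {g : ℝ → ℝ} (hg : ContDiff ℝ ∞ g) {cg : ℝ}
    (hgc : ∀ (n : ℕ) (x : ℝ), |iteratedDeriv n g x| ≤ cg ^ n * (n : ℝ) ^ (cg * n))
    {KV p μs vs : ℝ} (hV : ∀ φ, |vexp cv legs φ| ≤ KV) (hp1 : 1 ≤ p) (hμs : 0 ≤ μs) (hvs : 0 ≤ vs)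
    (hobsm : ∀ j, ∀ w ∈ obs j, |w ⬝ᵥ ((prec blk Δ W (corner ℝ W))⁻¹ *ᵥ src blk ℱ W)| ≤ μs ∧
      w ⬝ᵥ ((prec blk Δ W (corner ℝ W))⁻¹ *ᵥ w) ≤ vs)
    (hlegsm : ∀ m, ∀ w ∈ legs m, |w ⬝ᵥ ((prec blk Δ W (corner ℝ W))⁻¹ *ᵥ src blk ℱ W)| ≤ μs ∧
      w ⬝ᵥ ((prec blk Δ W (corner ℝ W))⁻¹ *ᵥ w) ≤ vs)
    (hθ0 : 0 < θ) (hθ1 : θ ≤ 1) (hBl : 1 ≤ Bl) (hcV0 : ∀ m, 0 ≤ cV m)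
    (hθv : 0 < θv) (hθv1 : θv ≤ 1) (hθw : 0 < θw) (hθw1 : θw ≤ 1) (hcV : ∀ m, |cv m| ≤ cV m)
    (hobs : ∀ j, ∀ w ∈ obs j, (∃ k, ∀ z, w z ≠ 0 → cube z = k) ∧ ‖w‖ ≤ Rinf ∧ ∑ x, |w x| ≤ R1)
    (hlegs : ∀ m, ∀ w ∈ legs m, (∃ k, ∀ z, w z ≠ 0 → cube z = k) ∧ ‖w‖ ≤ Rinf ∧ ∑ x, |w x| ≤ R1)
    (hvert : ∀ m, cV m * Bl ^ (legs m).length ≤ θv * θ ^ (vc m).card)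
    (hleg : ∀ m j x, ((legs m).getD j 0) x ≠ 0 → cube x = legCube m j)
    (hL : ∀ k, (∑ m, ((range (legs m).length).filter fun j => legCube m j = k).card) ≤ L)
    (h4 : 4 ≤ c * rek) (hθrek : Real.exp (-(c * rek / 4)) ≤ θ)
    (hBl' : Eloc * ((D * sc : ℕ) : ℝ) * (R1 * (Rinf + ‖src blk ℱ W‖ + 1)) ≤ Bl)
    (hθw' : Real.exp (-(c * rek / 4)) * sc * (R1 * (Rinf + ‖src blk ℱ W‖ + 1)) ≤ θw)
    (bdry : Finset κ)
    (hbeat : ∀ O : Finset κ, ∀ t ∈ expand (fun p : Option {X : Finset β // IsRConnected Rk X} =>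
        (Option.elim p (cLoc ldist ρr Cw) fun r => cX ldist ρr cubeOf cadj Cw r.1 :
          Matrix {x : α // blk x ∈ W} {x : α // blk x ∈ W} ℝ)) (fun p => Option.isSome p) (src blk ℱ W) cv legs obs
        M 0 O, t.consts = 0 → ∀ X ∈ t.groups,
      max p⁻¹ (max (θv ^ M) θw) * ∏ j ∈ X.lab.filter (fun j => j ∉ bdry), Bl ^ (obs j).length ≤ 1) :
    BIJ88Sect5StatementsPart4.Ineq312 (remSys κ β)
      (fun OX => remAt (prec blk Δ W (corner ℝ W)) (fun p : Option {X : Finset β // IsRConnected Rk X} =>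
          (Option.elim p (cLoc ldist ρr Cw) fun r => cX ldist ρr cubeOf cadj Cw r.1 :
            Matrix {x : α // blk x ∈ W} {x : α // blk x ∈ W} ℝ)) (fun p => Option.isSome p) (src blk ℱ W) cv legs obs M
        (fun ψ => ∏ b ∈ Bs, g (p⁻¹ * (ContinuousLinearMap.proj (y b) : ({x : α // blk x ∈ W} → ℝ) →L[ℝ] ℝ) ψ))
        oc vc (fun p => Option.elim p (∅ : Finset β) fun r => r.1) [] 0 OX.1 OX.2
        / ∫ φ, weight (prec blk Δ W (corner ℝ W)) φ * source (src blk ℱ W) φ)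
      (fun OX => KV * ((max 1 (max 1 cg * (max 1 (phi0 legs obs M OX.1 : ℝ)) ^ cg)) ^ phi0 legs obs M OX.1
            * ∑ N ∈ range (phi0 legs obs M OX.1 + 1), 2 ^ N * (μs ^ N + (1 + vs ^ N * ((2 * N - 1).doubleFactorial : ℝ))))
          * (max 1 (2 * (phi0 legs obs M OX.1 : ℝ) + L * ((D : ℝ) + 1))) ^ phi0 legs obs M OX.1)
      (fun OX => ∏ j ∈ OX.1.filter (fun j => j ∈ bdry), Bl ^ (obs j).length)
      (fun OX => nfreeOf oc OX.2) θ 1 := by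
  -- W6a: the seven clause inputs for the split family
  obtain ⟨hB0, hρ, hB, hBf, hBzN, hloc, hwalk⟩ := split245_letters ldist ρr cubeOf cadj Cw inBlock cube
    (IsRConnected Rk) h246 hblk hE0 hEloc sdist htri near hnear hD hsc Bs hy (src blk ℱ W) hRinf hR1
    (Dir := {u : {x : α // blk x ∈ W} → ℝ | (∃ k, ∀ z, u z ≠ 0 → cube z = k) ∧ ‖u‖ ≤ Rinf ∧ ∑ x, |u x| ≤ R1})
    (fun u hu => hu.2) h4 hθrek hBl' hθw'
  -- the reach data of the split (W4c) from the support inputs, and the per-cube sums (W4b on the subtype)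
  obtain ⟨hnone, hsome⟩ := split245_support_adm ldist ρr cubeOf cadj Cw inBlock cube (IsRConnected Rk) h246 hblk
    sdist htri near hnear
  obtain ⟨hin, hout⟩ := split_reach (cubeOf := cube) (near := near)
    (X := fun r : {X : Finset β // IsRConnected Rk X} => r.1)
    (Cov := fun p : Option {X : Finset β // IsRConnected Rk X} =>
      (Option.elim p (cLoc ldist ρr Cw) fun r => cX ldist ρr cubeOf cadj Cw r.1 :
        Matrix {x : α // blk x ∈ W} {x : α // blk x ∈ W} ℝ)) hnone hsome
  have hcs := split245_cube_sums Rk hRk hΔc hnbr (Real.exp_pos (-(c * rek / 2))).le hsmall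
  have hw := fun k => split_weights (near := near) (X := fun r : {X : Finset β // IsRConnected Rk X} => r.1)
    (ρ := fun p : Option {X : Finset β // IsRConnected Rk X} =>
      (Option.elim p 1 fun r => Real.exp (-(c * rek / 2)) ^ r.1.card : ℝ)) hρ hD (a := 1) (b := 1)
    (fun k => ?_) (fun k => ?_) k
  rotate_left
  · convert (hcs k).1; rfl
  · convert (hcs k).2; rfl
  -- `hL`: the head's leg-count clause carries the classical `DecidableEq` of its abstract cube type (`convert`)
  refine ineq312_remainder_bdry_prodCutoff_of_reach
    (Cov := fun p : Option {X : Finset β // IsRConnected Rk X} =>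
      (Option.elim p (cLoc ldist ρr Cw) fun r => cX ldist ρr cubeOf cadj Cw r.1 :
        Matrix {x : α // blk x ∈ W} {x : α // blk x ∈ W} ℝ))
    (trig := fun p => Option.isSome p) (reg := fun p => Option.elim p (∅ : Finset β) fun r => r.1)
    (Dir := {u : {x : α // blk x ∈ W} → ℝ | (∃ k, ∀ z, u z ≠ 0 → cube z = k) ∧ ‖u‖ ≤ Rinf ∧ ∑ x, |u x| ≤ R1})
    (ρ₀ := 2) (ρ₁ := (D : ℝ) + 1) (cubeOf := cube) (legCube := legCube) (L := L)
    hPD Bs (fun b => ContinuousLinearMap.proj (y b)) hg hgc hV hp1 hμs hvs hobsm hlegsm hθ0 hθ1 hBl hB0 hρ hcV0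
    hθv hθv1 hθw hθw1 hB hBf hBzN hcV (fun j w hw => hobs j w hw) (fun m w hw => hlegs m w hw) hloc hwalk hvert
    zero_le_two hin hout (fun u hu => hu.1) hleg (fun k => ?_)
    (fun k => (hw k).1.trans (by norm_num)) (fun k => (hw k).2.trans (le_of_eq (by simp only [Option.elim, one_mul])))
    bdry hbeat
  convert hL k

end Law

end Literature.MathematicalPhysics.QuantumFieldTheory.BalabanImbrieJaffe1984to88.BIJ88WalkIneq312Split245

end
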